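import Mathlib
import HarnessLib
import Summits.QuantumFields.YangMills.Theses.PencilRigidity
import Summits.QuantumFields.YangMills.Theorems.PencilRigidityCurvatureKernelBoundTwoPointLocalBoundScaling

/-!
# `CurvatureKernelBound` — stub L′ `SmearedToLocalDecay` (support for stmt-QuantumFields-11687, line `sixteen-charts-analytic-kernel`, skeleton v15)

`W₁` + the SMEARED lattice window bound (frequently in `k`: for real test functions `f 0, f 1`
supported in the balls `B̄(∓s e₀, ρ)`, `ρ ≤ s/2`, `a_k R₀ ≤ s ≤ θ`,
`|LS₂ − LS₁ LS₁| ≤ C s^(η−10) R_k(f 0) R_k(f 1)` with `R_k(g) = a_k⁴ Σ_{x ∈ box} |g(a_k x)|`)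
⇒ the local two-point decay near the time axis:
`‖S₁ 2 (f 0 ⊗ f 1)‖ ≤ A (∫|f 0|)(∫|f 1|) + B r⁸ M₀ M₁` with `A + B ≤ C_T s^(η_T − 10)`.

Route: the proof of `TwoPointLocalBoundScaling` with the per-pair step deleted. `S₁ 1 = κ∫` on real
one-point tensors (`BoundedRenormalisation.exists_degreeOne_eq_const_mul_realIntegral`); along a
subsequence `φ` on which the smeared bound holds, `a_{φ j} → 0`, so eventually `a_{φ j} < ρ` and
`a_{φ j} R₀ ≤ s`; the lattice point count `a⁴ Σ |g(a x)| ≤ (3ρ)⁴ M_g`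
(`SemiDegenerate.latticeSum_le_of_tsupport_subset_closedBall'`) turns the smeared bound into
`max C 0 · s^(η−10) (3ρ)⁸ M₀ M₁`, and the lattice tie of `W₁` at `n = 2, 1` passes it to the limit;
the disconnected part is `κ² (∫ f 0)(∫ f 1)`.
Constants: `η_T = min η 10`, `C_T = ‖κ‖² + 3⁸ max C 0`, `s₁ = min 1 θ`, `r₀ = s/2`, `A = ‖κ‖²`,
`B = 3⁸ max C 0 · s^(η−10)`. [folklore]
-/

noncomputable section

open scoped BigOperators Topology SchwartzMap ComplexConjugate InnerProductSpace
open MeasureTheory Filter Set Metric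
open Literature.MathematicalPhysics.QuantumLattice Literature.MathematicalPhysics.AQFT
open Literature.MathematicalPhysics.QuantumFieldTheory

open Literature.Probability.LatticeModels (box)

namespace Summit.QuantumFields.YangMills.Theorems.CurvatureKernel

namespace SmearedToLocalDecayAux

/-- **Constants of the smeared-to-local transfer.** For `0 < s ≤ 1`, `0 ≤ A`, `0 ≤ Q` and any `η`:
`A + Q s^(η−10) ≤ (A + Q) s^(min η 10 − 10)` (`1 ≤ s^(min η 10 − 10)` and
`s^(η−10) ≤ s^(min η 10 − 10)` as `s ≤ 1`). [folklore] -/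
theorem const_add_mul_rpow_le {A Q η s : ℝ} (hA : 0 ≤ A) (hQ : 0 ≤ Q) (hs : 0 < s) (hs1 : s ≤ 1) :
    A + Q * s ^ (η - 10) ≤ (A + Q) * s ^ (min η 10 - 10) := by
  have h1 : (1 : ℝ) ≤ s ^ (min η 10 - 10) :=
    Real.one_le_rpow_of_pos_of_le_one_of_nonpos hs hs1 (by linarith [min_le_right η 10])
  have h2 : s ^ (η - 10) ≤ s ^ (min η 10 - 10) :=
    Real.rpow_le_rpow_of_exponent_ge hs hs1 (by linarith [min_le_left η 10])
  have h3 : A * 1 ≤ A * s ^ (min η 10 - 10) := mul_le_mul_of_nonneg_left h1 hA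
  have h4 : Q * s ^ (η - 10) ≤ Q * s ^ (min η 10 - 10) := mul_le_mul_of_nonneg_left h2 hQ
  linarith

end SmearedToLocalDecayAux

open TwoPointLocal SemiDegenerate BoundedRenormalisation SmearedToLocalDecayAux in
/-- **Stub `SmearedToLocalDecay`** (L′ of line `sixteen-charts-analytic-kernel`, registered signature
verbatim): `W₁` + the smeared lattice window bound ⇒ the local two-point decay near the time axis,
with `η_T = min η 10`, `C_T = ‖κ‖² + 3⁸ max C 0`, `s₁ = min 1 θ`. See the module docstring. [folklore] -/
theorem SmearedToLocalDecay : open Literature.MathematicalPhysics.QuantumLattice Literature.MathematicalPhysics.AQFT Literature.MathematicalPhysics.QuantumFieldTheory in ∀ (G : Type) [Group G] [TopologicalSpace G] [IsTopologicalGroup G] [CompactSpace G] [MeasurableSpace G] [BorelSpace G], IsCompactSimpleLieGroup G → ∀ (r : LatticeRep G) (sch : SpeciesScheme (YMSpecies G)) (S₁ : SchwingerFamily (EuclideanSpace ℝ (Fin 4))), ((∀ (n : ℕ), n ≠ 0 → ∀ (f : Fin n → SchwartzMap (EuclideanSpace ℝ (Fin 4)) ℝ) (F : SchwartzMap (Fin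 n → (EuclideanSpace ℝ (Fin 4))) ℂ), IsTensorOf F (fun i => ofRealTest (f i)) → IsOffDiagonal F → Filter.Tendsto (fun k : ℕ => ((latticeSchwinger r.ρ sch (fun s => s.F) k n (fun _ => r.curvature) f : ℝ) : ℂ)) Filter.atTop (nhds (S₁ n F))) ∧ (S₁.toLabelled.IsNormalized ∧ S₁.toLabelled.IsHermitian ∧ S₁.toLabelled.HasLinearGrowth ∧ S₁.toLabelled.IsReflectionPositive ∧ S₁.toLabelled.IsSymmetric ∧ S₁.toLabelled.HasClusterProperty) ∧ (∀ (n : ℕ) (a : (EuclideanSpace ℝ (Fin 4))) (F : SchwartzMap (Fin n → (EuclideanSpace ℝ (Fin 4))) ℂ), IsOffDiagonal F → S₁ n (translateMulti a F) = S₁ n F) ∧ (∀ (R : (EuclideanSpace ℝ (Fin 4)) ≃ₗᵢ[ℝ] (EuclideanSpace ℝ (Fin 4))), LinearMap.det (R.toLinearEquiv : (EuclideanSpace ℝ (Fin 4)) →ₗ[ℝ] (EuclideanSpace ℝ (Fin 4))) = 1 → (∀ i : Fin 4, ∃ j : Fin 4, R (EuclideanSpace.single i 1) = EuclideanSpace.single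 j 1 ∨ R (EuclideanSpace.single i 1) = -EuclideanSpace.single j 1) → ∀ (n : ℕ) (F : SchwartzMap (Fin n → (EuclideanSpace ℝ (Fin 4))) ℂ), IsOffDiagonal F → S₁ n (linActMulti R F) = S₁ n F) ∧ (∃ Δ : ℝ, 0 < Δ ∧ S₁.toLabelled.HasMassGap Δ ∧ HasLatticeMassGap r sch Δ)) → (∃ (C η θ R₀ : ℝ), 0 < η ∧ 0 < θ ∧ ∃ᶠ k in Filter.atTop, ∀ (s ρ : ℝ), 0 < s → sch.a k * R₀ ≤ s → s ≤ θ → 0 < ρ → ρ ≤ s / 2 → ∀ (f : Fin 2 → SchwartzMap (EuclideanSpace ℝ (Fin 4)) ℝ), tsupport ((f 0 : SchwartzMap (EuclideanSpace ℝ (Fin 4)) ℝ) : (EuclideanSpace ℝ (Fin 4)) → ℝ) ⊆ Metric.closedBall (EuclideanSpace.single (0 : Fin 4) (-s)) ρ → tsupport ((f 1 : SchwartzMap (EuclideanSpace ℝ (Fin 4)) ℝ) : (EuclideanSpace ℝ (Fin 4)) → ℝ) ⊆ Metric.closedBall (EuclideanSpace.single (0 : Fin 4) s) ρ → |latticeSchwinger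 r.ρ sch (fun s => s.F) k 2 (fun _ => r.curvature) f - latticeSchwinger r.ρ sch (fun s => s.F) k 1 (fun _ => r.curvature) (fun _ => f 0) * latticeSchwinger r.ρ sch (fun s => s.F) k 1 (fun _ => r.curvature) (fun _ => f 1)| ≤ C * s ^ (η - 10) * ((sch.a k) ^ 4 * ∑ x ∈ Literature.Probability.LatticeModels.box 4 (sch.L k), |f 0 (sch.a k • siteToE x)|) * ((sch.a k) ^ 4 * ∑ x ∈ Literature.Probability.LatticeModels.box 4 (sch.L k), |f 1 (sch.a k • siteToE x)|)) → ∃ (C η s₁ : ℝ), 0 < η ∧ 0 < s₁ ∧ (∀ (s : ℝ), 0 < s → s < s₁ → ∃ (r₀ A B : ℝ), 0 < r₀ ∧ 0 ≤ A ∧ 0 ≤ B ∧ A + B ≤ C * s ^ (η - 10) ∧ (∀ (r : ℝ), 0 < r → r ≤ r₀ → ∀ (f : Fin 2 → SchwartzMap (EuclideanSpace ℝ (Fin 4)) ℝ) (F : SchwartzMap (Fin 2 → (EuclideanSpace ℝ (Fin 4))) ℂ) (M₀ M₁ : ℝ), IsTensorOf F (fun i => ofRealTest (f i)) → tsupport ((f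 0 : SchwartzMap (EuclideanSpace ℝ (Fin 4)) ℝ) : (EuclideanSpace ℝ (Fin 4)) → ℝ) ⊆ Metric.closedBall (EuclideanSpace.single (0 : Fin 4) (-s)) r → tsupport ((f 1 : SchwartzMap (EuclideanSpace ℝ (Fin 4)) ℝ) : (EuclideanSpace ℝ (Fin 4)) → ℝ) ⊆ Metric.closedBall (EuclideanSpace.single (0 : Fin 4) s) r → (∀ x, |f 0 x| ≤ M₀) → (∀ x, |f 1 x| ≤ M₁) → ‖S₁ 2 F‖ ≤ A * (∫ x : (EuclideanSpace ℝ (Fin 4)), |f 0 x|) * (∫ x : (EuclideanSpace ℝ (Fin 4)), |f 1 x|) + B * r ^ 8 * M₀ * M₁)) := by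
  intro G _ _ _ _ _ _ _ r sch S₁ hW₁ hSWB
  obtain ⟨htie, -, htr, -, -⟩ := hW₁
  obtain ⟨C, η, θ, R₀, hη, hθ, hfreq⟩ := hSWB
  obtain ⟨κ, hκ⟩ := exists_degreeOne_eq_const_mul_realIntegral S₁ htr
  -- a subsequence along which the smeared window bound holds
  obtain ⟨φ, hφmono, hφW⟩ := Filter.extraction_of_frequently_atTop hfreq
  have hφa : Tendsto (fun j => sch.a (φ j)) atTop (𝓝 0) := sch.tendsto_a.comp hφmono.tendsto_atTop
  -- constants
  obtain ⟨Cp, hCCp, hCpnn⟩ : ∃ Cp : ℝ, C ≤ Cp ∧ 0 ≤ Cp := ⟨max C 0, le_max_left _ _, le_max_right _ _⟩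
  refine ⟨‖κ‖ ^ 2 + 3 ^ 8 * Cp, min η 10, min 1 θ, lt_min hη (by norm_num), lt_min one_pos hθ, ?_⟩
  intro s hs hs₁
  have hs1 : s ≤ 1 := hs₁.le.trans (min_le_left _ _)
  have hsθ : s ≤ θ := hs₁.le.trans (min_le_right _ _)
  -- the constant of the smeared bound at separation `s`
  obtain ⟨D, hDdef, hDnn⟩ : ∃ D : ℝ, D = Cp * s ^ (η - 10) ∧ 0 ≤ D := ⟨_, rfl, by positivity⟩
  refine ⟨s / 2, ‖κ‖ ^ 2, 3 ^ 8 * D, half_pos hs, by positivity, by positivity, ?_, ?_⟩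
  · -- `A + B ≤ C_T s^(η_T − 10)`
    have key := const_add_mul_rpow_le (A := ‖κ‖ ^ 2) (Q := 3 ^ 8 * Cp) (η := η)
      (by positivity) (by positivity) hs hs1
    have hBD : (3 : ℝ) ^ 8 * D = 3 ^ 8 * Cp * s ^ (η - 10) := by rw [hDdef]; ring
    linarith
  · intro ρ hρ hρs f F M₀ M₁ hFt hsupp₀ hsupp₁ hM₀ hM₁
    have hM₀nn : 0 ≤ M₀ := (abs_nonneg _).trans (hM₀ 0)
    have hM₁nn : 0 ≤ M₁ := (abs_nonneg _).trans (hM₁ 0)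
    -- the two closed balls are disjoint, so `F` is off-diagonal
    have hdisj : Disjoint (tsupport ((f 0 : 𝓢(EuclideanSpace ℝ (Fin 4), ℝ)) : EuclideanSpace ℝ (Fin 4) → ℝ))
        (tsupport ((f 1 : 𝓢(EuclideanSpace ℝ (Fin 4), ℝ)) : EuclideanSpace ℝ (Fin 4) → ℝ)) :=
      Disjoint.mono hsupp₀ hsupp₁ (disjoint_closedBall_single hs hρs)
    have hFoff : IsOffDiagonal F := isOffDiagonal_of_isTensorOf_of_disjoint hFt hdisj
    obtain ⟨F₀, hF₀⟩ := exists_isTensorOf (n := 1) (fun _ : Fin 1 => ofRealTest (f 0))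
    obtain ⟨F₁, hF₁⟩ := exists_isTensorOf (n := 1) (fun _ : Fin 1 => ofRealTest (f 1))
    -- (1) lattice side: the smeared bound along the good subsequence, for small meshes
    have hsmallmesh : ∀ᶠ j in atTop, sch.a (φ j) < ρ ∧ sch.a (φ j) * R₀ < s := by
      refine (hφa.eventually (gt_mem_nhds hρ)).and ?_
      have ht : Tendsto (fun j => sch.a (φ j) * R₀) atTop (𝓝 (0 * R₀)) := hφa.mul_const R₀
      rw [zero_mul] at ht
      exact ht.eventually (gt_mem_nhds hs)
    have hlat : ∀ᶠ j in atTop,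
        ‖((latticeSchwinger r.ρ sch (fun s => s.F) (φ j) 2 (fun _ => r.curvature) f : ℝ) : ℂ) -
          ((latticeSchwinger r.ρ sch (fun s => s.F) (φ j) 1 (fun _ => r.curvature) (fun _ => f 0) : ℝ) : ℂ) *
          ((latticeSchwinger r.ρ sch (fun s => s.F) (φ j) 1 (fun _ => r.curvature) (fun _ => f 1) : ℝ) : ℂ)‖ ≤
        D * ((3 * ρ) ^ 4 * M₀) * ((3 * ρ) ^ 4 * M₁) := by
      filter_upwards [hsmallmesh] with j hj
      obtain ⟨hjρ, hjR⟩ := hj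
      have hak : 0 < sch.a (φ j) := sch.a_pos (φ j)
      have hwin := hφW j s ρ hs hjR.le hsθ hρ hρs f hsupp₀ hsupp₁
      have hR₀ := latticeSum_le_of_tsupport_subset_closedBall' hsupp₀ hM₀ hak hjρ.le (sch.L (φ j))
      have hR₁ := latticeSum_le_of_tsupport_subset_closedBall' hsupp₁ hM₁ hak hjρ.le (sch.L (φ j))
      have hX : 0 ≤ (sch.a (φ j)) ^ 4 * ∑ x ∈ box 4 (sch.L (φ j)), |f 0 (sch.a (φ j) • siteToE x)| := by
        positivity
      have hY : 0 ≤ (sch.a (φ j)) ^ 4 * ∑ x ∈ box 4 (sch.L (φ j)), |f 1 (sch.a (φ j) • siteToE x)| := by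
        positivity
      have hCD : C * s ^ (η - 10) ≤ D := by
        rw [hDdef]
        exact mul_le_mul_of_nonneg_right hCCp (Real.rpow_nonneg hs.le _)
      rw [← Complex.ofReal_mul, ← Complex.ofReal_sub, Complex.norm_real, Real.norm_eq_abs]
      refine hwin.trans ?_
      refine (mul_le_mul_of_nonneg_right (mul_le_mul_of_nonneg_right hCD hX) hY).trans ?_
      exact mul_le_mul (mul_le_mul_of_nonneg_left hR₀ hDnn) hR₁ hY (by positivity)
    -- the lattice tie along the subsequence
    have hu := (htie 2 two_ne_zero f F hFt hFoff).comp hφmono.tendsto_atTop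
    have hv := (htie 1 one_ne_zero (fun _ => f 0) F₀ hF₀
      (HypercubicLimit.Negative.isOffDiagonal_fin_one F₀)).comp hφmono.tendsto_atTop
    have hw := (htie 1 one_ne_zero (fun _ => f 1) F₁ hF₁
      (HypercubicLimit.Negative.isOffDiagonal_fin_one F₁)).comp hφmono.tendsto_atTop
    have hZ : ‖S₁ 2 F - S₁ 1 F₀ * S₁ 1 F₁‖ ≤ D * ((3 * ρ) ^ 4 * M₀) * ((3 * ρ) ^ 4 * M₁) :=
      le_of_tendsto (hu.sub (hv.mul hw)).norm hlat
    -- (2) the disconnected part is `κ² (∫ f₀)(∫ f₁)`, bounded by `‖κ‖² (∫|f₀|)(∫|f₁|)`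
    have hS1F₀ : S₁ 1 F₀ = κ * ((∫ y, f 0 y : ℝ) : ℂ) := hκ (f 0) F₀ hF₀
    have hS1F₁ : S₁ 1 F₁ = κ * ((∫ y, f 1 y : ℝ) : ℂ) := hκ (f 1) F₁ hF₁
    rw [hS1F₀, hS1F₁] at hZ
    have hP := norm_disconnected_le κ f
    -- (3) assembly
    have hfin := TwoPointLocal.norm_le_of_norm_sub_le hZ hP
    have hring : D * ((3 * ρ) ^ 4 * M₀) * ((3 * ρ) ^ 4 * M₁) = 3 ^ 8 * D * ρ ^ 8 * M₀ * M₁ := by ring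
    linarith

end Summit.QuantumFields.YangMills.Theorems.CurvatureKernel

end
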